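import Literature.AlgebraicGeometry.ModuliOfAbelianVarieties.SiegelFamilyRealStructuresCocycleCriterion
import Literature.AlgebraicGeometry.ModuliOfAbelianVarieties.SiegelFamilyModularGroupBridge
import Literature.AlgebraicGeometry.ModuliOfAbelianVarieties.SiegelFamilyRealPointsLevelTwo
import Literature.Geometry.Kaehler.ComplexTorusIsogenyDegree
import Literature.Geometry.Kaehler.ComplexTorusPhiHFunctorial
import Literature.GroupTheory.ArithmeticGroups.MinkowskiTorsionFree
import HarnessLib

/-!
# Goresky–Tai §6: level structures at the real points — the real structure `κ(γ, Z)` of `(A_Z, H_Z)` is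
# compatible with the standard level-`N` structure iff `γ ∈ Γ(N)` (Proposition 17), and the isomorphism
# `ψ = ρ(M) : A_Z → A_{Z′}` of (6.2) respects the standard level-`N` structures iff its matrix is `≡ 1 (mod N)`
# (Goresky–Tai 2003, §6.1 (6.1), Def. 16, §6.2 (6.2), §6.3 (6.5), Prop. 17; the level half of the proof of Thm. 18)

Topic `Literature/AlgebraicGeometry/ModuliOfAbelianVarieties` (the Siegel-family files, namespace
`Literature.AlgebraicGeometry.ModuliOfAbelianVarieties.SiegelModuli`).  Lane `lit-hodgefound` (Track 2
foundations library), prover seat p15 generation 53, row g53-#3, on top of g51-#1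
`SiegelFamilyRealStructuresCocycleCriterion` (GT §6.3: the group endomorphism **`κ(γ, Z) = ρ(M⁻¹K)`** of
`X_Z = ℂ^g/(Z, 1)ℤ^{2g}`, `γ = gDHom 𝟙 M = ι(ᵗM⁻¹) ∈ Γ_g`, `K = I₋ = (−1 0; 0 1)`, covered by `u ↦ ᵗ(CZ + D)ū`;
a real structure iff `τ(γ)γ = 1`, always `E_Z`-compatible), the bridge `SiegelFamilyModularGroupBridge`
(`gDHom 𝟙 M = ι(ᵗ(M⁻¹))`), g51-#4 (`Γ_g(q)` entrywise) and the tree's complex tori (`proj`, `mapMatrix`,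
`proj_eq_proj_iff_exists_intVec`).  THEOREMS ONLY: no definition, no instance, no notation, no named fact (net
Literature debt `0`), no `sorry`.

## Source, VERBATIM

M. Goresky, Y. S. Tai, Compositio Math. **139** (2003) = arXiv:math/0108103, held `paper:arxiv-math_0108103`,
§6.1 (p0010): «A level `N` structure on `A` is a choice of basis `{U_i, V_j}` (with `1 ≤ i, j ≤ n`) for the
`N`-torsion points of `A`, which is symplectic, in the sense that there exists a symplectic basis `{u_i, v_j}`
for `L` such that `U_i ≡ u_i/N` and `V_j ≡ v_j/N (mod L)` … A level `N`-structure `{U_i, V_j}` is compatible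
with a real structure `κ` if for some (and hence for any) lift `{u_i, v_j}` of the level structure,
`κ(u_i/N) ≡ −u_i/N (mod L)` and `κ(v_j/N) ≡ +v_j/N (mod L)` for all `1 ≤ i, j ≤ n`.  In other words, the
following diagram commutes `(mod L)`: (6.1) `F ∘ ᵗI₋ = κ ∘ F` on `(1/N)(ℤⁿ ⊕ ℤⁿ)`, where `I₋ = (−I 0; 0 I)`.
**Definition 16.** A real principally polarized abelian variety with level `N` structure is a quadruple
`𝒜 = (A = ℂⁿ/L, H = R + iQ, κ, {U_i, V_j})` where `(A, H, κ)` is a real principally polarized abelian variety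
and where `{U_i, V_j}` is a level `N`-structure which is compatible with `κ`.  An isomorphism … is a complex
linear mapping `φ : ℂⁿ → ℂⁿ` such that (a.), (b.), and (c.) of §6.1 hold, and such that
(d.) `φ(u_i/N) ≡ u′_i/N (mod L′)` and `φ(v_j/N) ≡ v′_j/N (mod L′)`.»  §6.2 (p0010): «`F_Z(x, y) = Zx + y` …
the collection `{F_Z(e_i/N), F_Z(f_i/N)} (mod L)` is a level `N` structure on `(A_Z, H_Z)`, which we refer to
as the standard level `N` structure.» (p0011, (6.2)): «Set `h = ᵗ(F_Z⁻¹ψF_Ω) = (A B; C D)`.  Then: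
`h ∈ Sp(2n, ℤ)`, `Ω = h · Z`, and `ψ(M) = ᵗ(CZ + D)M` … the following diagram commutes:
`ψ ∘ F_{h·Z} = F_Z ∘ ᵗh`.»  §6.3 (p0011): «Define `κ(γ, Z) : ℂⁿ → ℂⁿ` by `M ↦ ᵗ(CZ + D)M̄` … (6.5)
`κ(γ, Z) ∘ F_Z = F_Z ∘ ᵗγ ᵗI₋`.  **Proposition 17.**  Let `Z ∈ 𝔥_n` and `γ ∈ Sp(2n, ℝ)` and suppose that
`Z̃ = γ · Z`.  Then `γ ∈ Γ(N)` iff the real structure `κ(γ, Z)` on `(A_Z, H_Z)` is compatible with the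
standard level `N` structure, and in this case the quadruple `(A_Z, H_Z, κ(γ, Z), {F_Z(e_i/N), F_Z(f_j/N)})`
is a real principally polarized abelian variety with (compatible) level `N` structure.  The proof follows
immediately from the diagrams (6.5) and (6.1).»  §7.4 (p0013, proof of Theorem 18): «if there is an
isomorphism `ψ : 𝒜_Ω → 𝒜_Z` then by (6.2) there exists `h ∈ Sp(2n, ℤ)` such that `Ω = h · Z`.  Since the
mapping `ψ` also preserves the level structures, it follows also from (6.2) that `h ∈ Γ(N)`.»

## The tree's rendering (principal type `𝟙`, `X_Z = ComplexTorus (Φ_Z)`, `Φ_Z = siegelPeriodEquiv = F_Z`)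

Points of `X_Z` are written in the lattice coordinates `(x, y) ∈ ℝ^g ⊕ ℝ^g` of the symplectic basis
`F_Z(e_i), F_Z(f_j)` of `L_Z`: `proj Φ_Z (x, y) = F_Z(x, y) mod L_Z`.  The STANDARD LEVEL-`N` STRUCTURE is the
family `U_i = proj Φ_Z (e_i/N)`, `V_j = proj Φ_Z (f_j/N)` (`Pi.single (inl i) N⁻¹`, `Pi.single (inr j) N⁻¹`);
a homomorphism of tori with integer (rational-representation) matrix `A` is `mapMatrix Φ Φ′ A`
(`ρ(A) ∘ proj = proj ∘ A`); GT's `κ(γ, Z)`, of lattice matrix `ᵗγ ᵗI₋`, is g51-#1's `ρ(M⁻¹K)`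
(`γ = gDHom 𝟙 M`, `ᵗγ = M⁻¹` as integer matrices); `ρ(K)` is `(x, y) ↦ (−x, y)`, so «compatible» reads
`κ(U_i) = −U_i = ρ(K) U_i`, `κ(V_j) = V_j = ρ(K) V_j`.  «`γ ∈ Γ(N)`» reads `gDHom 𝟙 M ∈ ι(Γ_g(N))`
(`Γ_g(N) = siegelPrincipalGamma g N`, `ι = symplecticIntHom g`).

## What is proved

* §1 (any complex torus) `mapMatrix_proj_single_inv` (`ρ(A)(proj(e_k/N)) = proj(A e_k/N)`),
  **`forall_mapMatrix_proj_single_eq_iff_forall_dvd`** (two homomorphisms `ρ(A)`, `ρ(B)` AGREE ON THE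
  STANDARD `N`-DIVISION POINTS `proj(e_k/N)` iff `A ≡ B (mod N)`), `mapMatrix_eq_of_forall_dvd_of_nsmul_eq_zero`
  (then they agree on every `N`-torsion point; `mapMatrix_add_matrix` of the tree), `forall_dvd_sub_iff_map_eq` (`A ≡ B (mod N)` iff equal
  reductions in `M(ℤ/N)`), `map_coe_inv_eq_one_iff` (`M⁻¹ ≡ 1 ⟺ M ≡ 1` for `M ∈ GL(ℤ)`).
* §2 **`gDHom_mem_map_siegelPrincipalGamma_iff_map_eq_one`**: `γ = gDHom 𝟙 M ∈ ι(Γ_g(N)) ⟺ M ≡ 1 (mod N)`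
  (the bridge `γ = ι(ᵗM⁻¹)`).
* §3 **PROPOSITION 17** (torus level, for every `M ∈ Sp_𝟙(ℤ)`; GT's hypothesis `γ · Z = Z̃` is what makes
  `ρ(M⁻¹K)` the real structure `κ(γ, Z)`, g51-#1, and is not needed for the equivalence itself):
  `mapMatrix_conjK_proj_single_inl` / `_inr` (`ρ(K)U_i = −U_i`, `ρ(K)V_j = V_j`),
  **`forall_mapMatrix_inv_mul_conjK_proj_single_iff_mem`** (`κ(proj(e_k/N)) = ρ(K)(proj(e_k/N))` for all
  `k` ⟺ `γ ∈ ι(Γ_g(N))`), the literal form **`kappa_compatible_iff_mem_map_siegelPrincipalGamma`**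
  («`κ(u_i/N) ≡ −u_i/N` and `κ(v_j/N) ≡ +v_j/N` … iff `γ ∈ Γ(N)`»), and the upgrade to all `N`-torsion
  points `mapMatrix_inv_mul_conjK_eq_of_mem_of_nsmul_eq_zero` («for some (and hence for any) lift»: `κ = ρ(K)` on
  `X_Z[N]` when `γ ∈ Γ(N)`).
* §4 THE LEVEL HALF OF (6.2) / THEOREM 18: **`forall_mapMatrix_proj_single_eq_proj_single_iff_mem`** — the
  homomorphism `ρ(M) : X_Z → X_{Z′}` (for `Z′ = gDHom 𝟙 M • Z` it is the isomorphism `ψ` of (6.2), holomorphic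
  with analytic representation `ᵗ(CZ + D)` by g51-#1 `exists_analyticRep_of_gDHom_smul_eq`) carries the standard
  level-`N` structure of `X_Z` ONTO that of `X_{Z′}`, `ρ(M)(proj_Z(e_k/N)) = proj_{Z′}(e_k/N)` for all `k`, iff
  `M ≡ 1 (mod N)`, iff `gDHom 𝟙 M ∈ ι(Γ_g(N))` («Since the mapping `ψ` also preserves the level structures, it
  follows also from (6.2) that `h ∈ Γ(N)`»).

## References

* [GoreskyTai2003RealModuli] M. Goresky, Y. S. Tai, Compositio Math. 139 (2003) 1–27 (arXiv:math/0108103),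
  §6.1 (6.1), Definition 16, §6.2 (6.2), §6.3 (6.4)–(6.5), Proposition 17, §7.4 (proof of Theorem 18).
* [Lange2023AbelianVarietiesComplex] H. Lange, *Abelian Varieties over the Complex Numbers* (2023), §1.1.2
  (rational representation, Prop. 1.1.14 `X_n ≃ Λ/nΛ`), §3.1.4 (3.7)–(3.8) (`σ_{1_g}`, `G_{1_g} = Sp_{2g}(ℤ)`).
-/

noncomputable section

open scoped Matrix ComplexConjugate
open Matrix Function

namespace Literature.AlgebraicGeometry.ModuliOfAbelianVarieties

namespace SiegelModuli

open Literature.NumberTheory.Automorphic (siegelUpperHalfSpace)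
open Literature.NumberTheory.ModularForms.SiegelUpperHalfSpace (symplecticIntHom siegelModularGroup
  symplecticIntHom_injective)
open Literature.NumberTheory.ModularForms.SiegelModularForm (siegelPrincipalGamma mem_siegelPrincipalGamma_iff)
open Literature.Geometry.Kaehler Literature.Geometry.Kaehler.ComplexTorus

/-! ## §1 Homomorphisms of complex tori on the standard `N`-division points `proj(e_k/N)` -/

section General

variable {ι ι' : Type*} [Fintype ι] [DecidableEq ι]
  {E E' : Type*} [NormedAddCommGroup E] [NormedSpace ℂ E] [NormedAddCommGroup E'] [NormedSpace ℂ E']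
  (Φ : (ι → ℝ) ≃L[ℝ] E) (Φ' : (ι' → ℝ) ≃L[ℝ] E')

/-- `ρ(A)(proj(e_k/N)) = proj'(A e_k/N) = proj'(k-th column of A / N)`: a homomorphism of tori acts on the
standard `N`-division points through its integer matrix. [cite: GoreskyTai2003RealModuli, §6.1 («`U_i ≡ u_i/N`») and §6.2 (6.2)] [cite: Lange2023AbelianVarietiesComplex, §1.1.2 Prop. 1.1.14] -/
theorem mapMatrix_proj_single_inv (A : Matrix ι' ι ℤ) (k : ι) (N : ℕ) :
    mapMatrix Φ Φ' A (proj Φ (Pi.single k ((N : ℝ)⁻¹))) = proj Φ' (fun i ↦ (A i k : ℝ) / N) := by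
  rw [mapMatrix_proj]
  refine congrArg (proj Φ') (funext fun i ↦ ?_)
  simp [Matrix.mulVec_single, div_eq_mul_inv]

/-- **Two homomorphisms `ρ(A), ρ(B) : X → X′` agree on the standard `N`-division points `proj(e_k/N)`
(`N ≥ 1`) iff `A ≡ B (mod N)`** (`proj′(A e_k/N) = proj′(B e_k/N)` iff `(A − B)e_k ∈ Nℤ^{ι′}`).
[cite: GoreskyTai2003RealModuli, §6.1 (6.1) («the following diagram commutes `(mod L)`»)] [cite: Lange2023AbelianVarietiesComplex, §1.1.2 Prop. 1.1.14] -/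
theorem forall_mapMatrix_proj_single_eq_iff_forall_dvd (A B : Matrix ι' ι ℤ) {N : ℕ} (hN : 0 < N) :
    (∀ k, mapMatrix Φ Φ' A (proj Φ (Pi.single k ((N : ℝ)⁻¹))) =
        mapMatrix Φ Φ' B (proj Φ (Pi.single k ((N : ℝ)⁻¹)))) ↔
      ∀ i k, (N : ℤ) ∣ (A - B) i k := by
  have hN' : (N : ℝ) ≠ 0 := by exact_mod_cast hN.ne'
  simp only [mapMatrix_proj_single_inv, proj_eq_proj_iff_exists_intVec]
  constructor
  · intro h i k
    obtain ⟨n, hn⟩ := h k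
    have hi := congr_fun hn i
    simp only [Pi.add_apply, intVec] at hi
    refine ⟨-n i, ?_⟩
    have : ((A i k : ℤ) : ℝ) - B i k = N * (-(n i : ℤ) : ℤ) := by
      push_cast
      field_simp at hi
      linarith
    rw [Matrix.sub_apply]
    exact_mod_cast this
  · intro h k
    choose n hn using fun i ↦ h i k
    refine ⟨fun i ↦ -n i, funext fun i ↦ ?_⟩
    simp only [Pi.add_apply, intVec]
    have hi := hn i
    rw [Matrix.sub_apply] at hi
    have : ((A i k : ℤ) : ℝ) - B i k = N * (n i : ℤ) := by exact_mod_cast hi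
    push_cast
    field_simp
    linarith

omit [DecidableEq ι] in
/-- **«for some (and hence for any) lift»**: if `A ≡ B (mod N)` then `ρ(A)` and `ρ(B)` agree on EVERY
`N`-torsion point (`A = B + NC`, `ρ(NC)t = ρ(C)(Nt) = 0`). [cite: GoreskyTai2003RealModuli, §6.1 («for some (and hence for any) lift `{u_i, v_j}` of the level structure»)] [cite: Lange2023AbelianVarietiesComplex, §1.1.2 Prop. 1.1.14] -/
theorem mapMatrix_eq_of_forall_dvd_of_nsmul_eq_zero {A B : Matrix ι' ι ℤ} {N : ℕ}
    (h : ∀ i k, (N : ℤ) ∣ (A - B) i k) {t : ComplexTorus Φ} (ht : N • t = 0) :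
    mapMatrix Φ Φ' A t = mapMatrix Φ Φ' B t := by
  choose C hC using h
  have hA : A = B + (N : ℤ) • Matrix.of fun i k ↦ C i k := by
    ext i k
    have := hC i k
    rw [Matrix.sub_apply] at this
    simp only [Matrix.add_apply, Matrix.smul_apply, Matrix.of_apply, smul_eq_mul]
    linarith
  rw [hA, mapMatrix_add_matrix, mapMatrix_smul, add_eq_left, natCast_zsmul, ← mapMatrixHom_apply, ← map_nsmul, ht,
    map_zero]

/-- `A ≡ B (mod N)` entrywise iff `A` and `B` have the same reduction in `M(ℤ/N)`.
[cite: GoreskyTai2003RealModuli, §4.1 («`Γ(N) = {γ ∈ Γ(1) | γ ≡ I (mod N)}`»)] -/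
theorem forall_dvd_sub_iff_map_eq {m n : Type*} (A B : Matrix m n ℤ) (N : ℕ) :
    (∀ i j, (N : ℤ) ∣ (A - B) i j) ↔ A.map (Int.castRingHom (ZMod N)) = B.map (Int.castRingHom (ZMod N)) := by
  rw [← Matrix.ext_iff]
  refine forall_congr' fun i ↦ forall_congr' fun j ↦ ?_
  rw [Matrix.sub_apply, Matrix.map_apply, Matrix.map_apply, eq_comm, Int.coe_castRingHom,
    ZMod.intCast_eq_intCast_iff_dvd_sub]

/-- **`M⁻¹ ≡ 1 (mod N) ⟺ M ≡ 1 (mod N)`** for `M ∈ GL(ℤ)` (reductions: `M̄ · M̄⁻¹ = 1`).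
[cite: GoreskyTai2003RealModuli, §4.1 (the groups `Γ(N)`)] -/
theorem map_coe_inv_eq_one_iff {n : Type*} [Fintype n] [DecidableEq n] (M : GL n ℤ) (N : ℕ) :
    ((M⁻¹ : GL n ℤ) : Matrix n n ℤ).map (Int.castRingHom (ZMod N)) = 1 ↔
      (M : Matrix n n ℤ).map (Int.castRingHom (ZMod N)) = 1 := by
  have h1 : (M : Matrix n n ℤ).map (Int.castRingHom (ZMod N)) *
      ((M⁻¹ : GL n ℤ) : Matrix n n ℤ).map (Int.castRingHom (ZMod N)) = 1 := by
    rw [← Matrix.map_mul, ← Units.val_mul, mul_inv_cancel, Units.val_one,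
      Matrix.map_one _ (map_zero _) (map_one _)]
  have h2 : ((M⁻¹ : GL n ℤ) : Matrix n n ℤ).map (Int.castRingHom (ZMod N)) *
      (M : Matrix n n ℤ).map (Int.castRingHom (ZMod N)) = 1 := by
    rw [← Matrix.map_mul, ← Units.val_mul, inv_mul_cancel, Units.val_one,
      Matrix.map_one _ (map_zero _) (map_one _)]
  constructor
  · intro h; rw [h, Matrix.mul_one] at h1; exact h1
  · intro h; rw [h, Matrix.mul_one] at h2; exact h2

end General

/-! ## §2 «`γ ∈ Γ(N)`» across the bridge `γ = gDHom 𝟙 M = ι(ᵗM⁻¹)`: iff `M ≡ 1 (mod N)` -/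

section Level

variable {g : ℕ} (hδ : ∀ i, 0 < (1 : Fin g → ℕ) i)

/-- **`γ = gDHom 𝟙 M ∈ Γ_g(N) ⟺ M ≡ 1 (mod N)`**: through the bridge `gDHom 𝟙 M = ι(ᵗ(M⁻¹))`
(`SiegelFamilyModularGroupBridge`), membership of `γ` in `ι(Γ_g(N))` is `ᵗ(M⁻¹) ≡ 1`, i.e. `M⁻¹ ≡ 1`, i.e.
`M ≡ 1 (mod N)` — GT's integer matrix `ᵗγ` IS `M⁻¹`. [cite: GoreskyTai2003RealModuli, §4.1 («`Γ(N) = {γ ∈ Γ(1) | γ ≡ I (mod N)}`»), §6.3 (6.5)] [cite: Lange2023AbelianVarietiesComplex, §3.1.4 (3.7)–(3.8), p. 163] -/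
theorem gDHom_mem_map_siegelPrincipalGamma_iff_map_eq_one (M : symplecticLatticeGroup (1 : Fin g → ℕ)) (N : ℕ) :
    gDHom (1 : Fin g → ℕ) hδ M ∈ (siegelPrincipalGamma g N).map (symplecticIntHom g) ↔
      ((M : GL (Fin g ⊕ Fin g) ℤ) : Matrix (Fin g ⊕ Fin g) (Fin g ⊕ Fin g) ℤ).map (Int.castRingHom (ZMod N)) = 1 := by
  have e : gDHom (1 : Fin g → ℕ) hδ M = symplecticIntHom g ⟨_, transpose_coe_inv_mem_symplecticGroup_int M⟩ :=
    gDHom_principal_eq_symplecticIntHom M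
  rw [e, Subgroup.mem_map_iff_mem symplecticIntHom_injective, mem_siegelPrincipalGamma_iff]
  change ((((M⁻¹ : symplecticLatticeGroup (1 : Fin g → ℕ)) : GL (Fin g ⊕ Fin g) ℤ) :
      Matrix (Fin g ⊕ Fin g) (Fin g ⊕ Fin g) ℤ)ᵀ).map (Int.castRingHom (ZMod N)) = 1 ↔ _
  rw [Matrix.transpose_map, Matrix.transpose_eq_one, Subgroup.coe_inv, map_coe_inv_eq_one_iff]

/-- The same as an entrywise congruence: `gDHom 𝟙 M ∈ ι(Γ_g(N)) ⟺ N ∣ (M − 1)_{ij}` for all `i, j`.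
[cite: GoreskyTai2003RealModuli, §4.1, §6.3 Prop. 17] -/
theorem gDHom_mem_map_siegelPrincipalGamma_iff_forall_dvd (M : symplecticLatticeGroup (1 : Fin g → ℕ)) (N : ℕ) :
    gDHom (1 : Fin g → ℕ) hδ M ∈ (siegelPrincipalGamma g N).map (symplecticIntHom g) ↔
      ∀ i j, (N : ℤ) ∣ (((M : GL (Fin g ⊕ Fin g) ℤ) : Matrix (Fin g ⊕ Fin g) (Fin g ⊕ Fin g) ℤ) - 1) i j := by
  rw [gDHom_mem_map_siegelPrincipalGamma_iff_map_eq_one, forall_dvd_sub_iff_map_eq,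
    Matrix.map_one _ (map_zero _) (map_one _)]

/-! ## §3 PROPOSITION 17: `κ(γ, Z)` is compatible with the standard level-`N` structure iff `γ ∈ Γ(N)` -/

variable {Z : Matrix (Fin g) (Fin g) ℂ} (hZ : Z ∈ siegelUpperHalfSpace g)

/-- **`ρ(K)U_i = −U_i`**: `K = I₋ = (−1 0; 0 1)` negates the first half `e_i/N` of the standard level-`N`
structure (`ᵗI₋ (x, y) = (−x, y)`). [cite: GoreskyTai2003RealModuli, §6.1 (6.1) («`κ(u_i/N) ≡ −u_i/N`», `I₋ = (−I 0; 0 I)`)] -/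
theorem mapMatrix_conjK_proj_single_inl (i : Fin g) (N : ℕ) :
    mapMatrix (siegelPeriodEquiv hδ hZ) (siegelPeriodEquiv hδ hZ)
        (Matrix.fromBlocks (-1 : Matrix (Fin g) (Fin g) ℤ) 0 0 (1 : Matrix (Fin g) (Fin g) ℤ))
        (proj (siegelPeriodEquiv hδ hZ) (Pi.single (Sum.inl i) ((N : ℝ)⁻¹))) =
      -proj (siegelPeriodEquiv hδ hZ) (Pi.single (Sum.inl i) ((N : ℝ)⁻¹)) := by
  rw [mapMatrix_proj_single_inv, ← projHom_apply, ← projHom_apply, ← map_neg, projHom_apply, projHom_apply]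
  refine congrArg (proj _) (funext fun k ↦ ?_)
  rcases k with k | k
  · by_cases hk : k = i
    · subst hk; simp [div_eq_mul_inv]
    · simp [hk, div_eq_mul_inv]
  · simp [div_eq_mul_inv]

/-- **`ρ(K)V_j = V_j`**: `K` fixes the second half `f_j/N` of the standard level-`N` structure.
[cite: GoreskyTai2003RealModuli, §6.1 (6.1) («`κ(v_j/N) ≡ +v_j/N`»)] -/
theorem mapMatrix_conjK_proj_single_inr (j : Fin g) (N : ℕ) :
    mapMatrix (siegelPeriodEquiv hδ hZ) (siegelPeriodEquiv hδ hZ)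
        (Matrix.fromBlocks (-1 : Matrix (Fin g) (Fin g) ℤ) 0 0 (1 : Matrix (Fin g) (Fin g) ℤ))
        (proj (siegelPeriodEquiv hδ hZ) (Pi.single (Sum.inr j) ((N : ℝ)⁻¹))) =
      proj (siegelPeriodEquiv hδ hZ) (Pi.single (Sum.inr j) ((N : ℝ)⁻¹)) := by
  rw [mapMatrix_proj_single_inv]
  refine congrArg (proj _) (funext fun k ↦ ?_)
  rcases k with k | k
  · simp [div_eq_mul_inv]
  · by_cases hk : k = j
    · subst hk; simp [div_eq_mul_inv]
    · simp [hk, div_eq_mul_inv]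

/-- **PROPOSITION 17 (Goresky–Tai), torus level.**  For `M ∈ Sp_𝟙(ℤ)`, `γ = gDHom 𝟙 M ∈ Γ_g`, the
endomorphism `κ = ρ(M⁻¹K)` of `X_Z` (GT's `κ(γ, Z)`, of lattice matrix `ᵗγ ᵗI₋`, (6.5)) satisfies
`κ(proj(e_k/N)) = ρ(K)(proj(e_k/N))` for every standard `N`-division point (`N ≥ 1`) — i.e. (6.1) commutes on
the standard level-`N` structure — **iff `γ ∈ Γ_g(N)`** («Then `γ ∈ Γ(N)` iff the real structure `κ(γ, Z)`
on `(A_Z, H_Z)` is compatible with the standard level `N` structure»; `M⁻¹K ≡ K ⟺ M ≡ 1 (mod N)`).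
[cite: GoreskyTai2003RealModuli, §6.3 Proposition 17 with (6.1), (6.5)] -/
theorem forall_mapMatrix_inv_mul_conjK_proj_single_iff_mem (M : symplecticLatticeGroup (1 : Fin g → ℕ))
    {N : ℕ} (hN : 0 < N) :
    (∀ k, mapMatrix (siegelPeriodEquiv hδ hZ) (siegelPeriodEquiv hδ hZ)
          ((((M⁻¹ : symplecticLatticeGroup (1 : Fin g → ℕ)) : GL (Fin g ⊕ Fin g) ℤ) :
              Matrix (Fin g ⊕ Fin g) (Fin g ⊕ Fin g) ℤ) *
            Matrix.fromBlocks (-1 : Matrix (Fin g) (Fin g) ℤ) 0 0 (1 : Matrix (Fin g) (Fin g) ℤ))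
          (proj (siegelPeriodEquiv hδ hZ) (Pi.single k ((N : ℝ)⁻¹))) =
        mapMatrix (siegelPeriodEquiv hδ hZ) (siegelPeriodEquiv hδ hZ)
          (Matrix.fromBlocks (-1 : Matrix (Fin g) (Fin g) ℤ) 0 0 (1 : Matrix (Fin g) (Fin g) ℤ))
          (proj (siegelPeriodEquiv hδ hZ) (Pi.single k ((N : ℝ)⁻¹)))) ↔
      gDHom (1 : Fin g → ℕ) hδ M ∈ (siegelPrincipalGamma g N).map (symplecticIntHom g) := by
  rw [forall_mapMatrix_proj_single_eq_iff_forall_dvd _ _ _ _ hN, forall_dvd_sub_iff_map_eq,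
    gDHom_mem_map_siegelPrincipalGamma_iff_map_eq_one, ← map_coe_inv_eq_one_iff, Subgroup.coe_inv, Matrix.map_mul]
  -- `K̄` is invertible (`K² = 1`): `Ā K̄ = K̄ ⟺ Ā = 1`
  have hKK : (Matrix.fromBlocks (-1 : Matrix (Fin g) (Fin g) ℤ) 0 0 (1 : Matrix (Fin g) (Fin g) ℤ)).map
        (Int.castRingHom (ZMod N)) *
      (Matrix.fromBlocks (-1 : Matrix (Fin g) (Fin g) ℤ) 0 0 (1 : Matrix (Fin g) (Fin g) ℤ)).map
        (Int.castRingHom (ZMod N)) = 1 := by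
    rw [← Matrix.map_mul, Matrix.fromBlocks_multiply]
    simp only [Matrix.mul_neg, Matrix.mul_one, neg_neg, Matrix.mul_zero, add_zero, zero_add, neg_zero,
      Matrix.fromBlocks_one]
    exact Matrix.map_one _ (map_zero _) (map_one _)
  constructor
  · intro h
    have := congrArg (· * (Matrix.fromBlocks (-1 : Matrix (Fin g) (Fin g) ℤ) 0 0 (1 : Matrix (Fin g) (Fin g) ℤ)).map
      (Int.castRingHom (ZMod N))) h
    simpa only [Matrix.mul_assoc, hKK, Matrix.mul_one] using this
  · intro h
    rw [h, Matrix.one_mul]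

/-- **PROPOSITION 17, as printed on the standard level-`N` structure `U_i = proj(e_i/N)`, `V_j = proj(f_j/N)`**:
«`κ(u_i/N) ≡ −u_i/N (mod L)` and `κ(v_j/N) ≡ +v_j/N (mod L)` for all `1 ≤ i, j ≤ n`» holds for
`κ = κ(γ, Z) = ρ(M⁻¹K)` iff `γ = gDHom 𝟙 M ∈ Γ_g(N)`. [cite: GoreskyTai2003RealModuli, §6.1 (6.1) and §6.3 Proposition 17] -/
theorem kappa_compatible_iff_mem_map_siegelPrincipalGamma (M : symplecticLatticeGroup (1 : Fin g → ℕ))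
    {N : ℕ} (hN : 0 < N) :
    ((∀ i : Fin g, mapMatrix (siegelPeriodEquiv hδ hZ) (siegelPeriodEquiv hδ hZ)
          ((((M⁻¹ : symplecticLatticeGroup (1 : Fin g → ℕ)) : GL (Fin g ⊕ Fin g) ℤ) :
              Matrix (Fin g ⊕ Fin g) (Fin g ⊕ Fin g) ℤ) *
            Matrix.fromBlocks (-1 : Matrix (Fin g) (Fin g) ℤ) 0 0 (1 : Matrix (Fin g) (Fin g) ℤ))
          (proj (siegelPeriodEquiv hδ hZ) (Pi.single (Sum.inl i) ((N : ℝ)⁻¹))) =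
        -proj (siegelPeriodEquiv hδ hZ) (Pi.single (Sum.inl i) ((N : ℝ)⁻¹))) ∧
      ∀ j : Fin g, mapMatrix (siegelPeriodEquiv hδ hZ) (siegelPeriodEquiv hδ hZ)
          ((((M⁻¹ : symplecticLatticeGroup (1 : Fin g → ℕ)) : GL (Fin g ⊕ Fin g) ℤ) :
              Matrix (Fin g ⊕ Fin g) (Fin g ⊕ Fin g) ℤ) *
            Matrix.fromBlocks (-1 : Matrix (Fin g) (Fin g) ℤ) 0 0 (1 : Matrix (Fin g) (Fin g) ℤ))
          (proj (siegelPeriodEquiv hδ hZ) (Pi.single (Sum.inr j) ((N : ℝ)⁻¹))) =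
        proj (siegelPeriodEquiv hδ hZ) (Pi.single (Sum.inr j) ((N : ℝ)⁻¹))) ↔
      gDHom (1 : Fin g → ℕ) hδ M ∈ (siegelPrincipalGamma g N).map (symplecticIntHom g) := by
  rw [← forall_mapMatrix_inv_mul_conjK_proj_single_iff_mem hδ hZ M hN, Sum.forall]
  simp only [mapMatrix_conjK_proj_single_inl, mapMatrix_conjK_proj_single_inr]

/-- **«for some (and hence for any) lift»: if `γ = gDHom 𝟙 M ∈ Γ_g(N)` then `κ(γ, Z) = ρ(K)` on ALL of
`X_Z[N]`** — every `N`-torsion point `t` has `κ t = ρ(K) t` (not only the basis `U_i, V_j`).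
[cite: GoreskyTai2003RealModuli, §6.1 (6.1), §6.3 Proposition 17] -/
theorem mapMatrix_inv_mul_conjK_eq_of_mem_of_nsmul_eq_zero (M : symplecticLatticeGroup (1 : Fin g → ℕ)) {N : ℕ}
    (hM : gDHom (1 : Fin g → ℕ) hδ M ∈ (siegelPrincipalGamma g N).map (symplecticIntHom g))
    {t : ComplexTorus (siegelPeriodEquiv hδ hZ)} (ht : N • t = 0) :
    mapMatrix (siegelPeriodEquiv hδ hZ) (siegelPeriodEquiv hδ hZ)
        ((((M⁻¹ : symplecticLatticeGroup (1 : Fin g → ℕ)) : GL (Fin g ⊕ Fin g) ℤ) :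
            Matrix (Fin g ⊕ Fin g) (Fin g ⊕ Fin g) ℤ) *
          Matrix.fromBlocks (-1 : Matrix (Fin g) (Fin g) ℤ) 0 0 (1 : Matrix (Fin g) (Fin g) ℤ)) t =
      mapMatrix (siegelPeriodEquiv hδ hZ) (siegelPeriodEquiv hδ hZ)
        (Matrix.fromBlocks (-1 : Matrix (Fin g) (Fin g) ℤ) 0 0 (1 : Matrix (Fin g) (Fin g) ℤ)) t := by
  rcases Nat.eq_zero_or_pos N with rfl | hN
  · -- `N = 0`: every matrix is `≡ 1 (mod 0)` only if it is `1`; here `0 • t = 0` is no condition, but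
    -- `Γ_g(0) = {1}` forces `M = 1`
    rw [gDHom_mem_map_siegelPrincipalGamma_iff_forall_dvd] at hM
    refine mapMatrix_eq_of_forall_dvd_of_nsmul_eq_zero _ _ (N := 0) (fun i k ↦ ?_) ht
    have hM1 : (((M : GL (Fin g ⊕ Fin g) ℤ) : Matrix (Fin g ⊕ Fin g) (Fin g ⊕ Fin g) ℤ)) = 1 := by
      ext i j; have := hM i j; simp only [Nat.cast_zero, zero_dvd_iff, Matrix.sub_apply] at this; linarith
    have hMinv : ((((M⁻¹ : symplecticLatticeGroup (1 : Fin g → ℕ)) : GL (Fin g ⊕ Fin g) ℤ) :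
        Matrix (Fin g ⊕ Fin g) (Fin g ⊕ Fin g) ℤ)) = 1 := by
      rw [Subgroup.coe_inv]
      have h := Units.inv_mul (M : GL (Fin g ⊕ Fin g) ℤ)
      rw [hM1, Matrix.mul_one] at h
      exact h
    rw [hMinv, Matrix.one_mul, sub_self]
    exact dvd_zero _
  · rw [← forall_mapMatrix_inv_mul_conjK_proj_single_iff_mem hδ hZ M hN,
      forall_mapMatrix_proj_single_eq_iff_forall_dvd _ _ _ _ hN] at hM
    exact mapMatrix_eq_of_forall_dvd_of_nsmul_eq_zero _ _ hM ht

/-! ## §4 The level half of (6.2): `ρ(M) : X_Z → X_{Z′}` respects the standard level-`N` structures iff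
## `M ≡ 1 (mod N)` iff `gDHom 𝟙 M ∈ Γ_g(N)` -/

/-- **The isomorphism `ψ = ρ(M)` of (6.2) and level structures.**  For `M ∈ Sp_𝟙(ℤ)` and ANY `Z, Z′ ∈ 𝔥_g`
(for `Z′ = gDHom 𝟙 M • Z` the homomorphism `ρ(M) : X_Z → X_{Z′}` is the holomorphic isomorphism `ψ` with
analytic representation `ᵗ(CZ + D)`, g51-#1 `exists_analyticRep_of_gDHom_smul_eq`; GT: «`ψ ∘ F_{h·Z} = F_Z ∘ ᵗh`»):
`ρ(M)` carries the standard level-`N` structure of `X_Z` termwise ONTO that of `X_{Z′}`,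
`ρ(M)(proj_Z(e_k/N)) = proj_{Z′}(e_k/N)` for all `k` (condition (d.) of Definition 16), **iff `M ≡ 1 (mod N)`,
iff `gDHom 𝟙 M ∈ Γ_g(N)`** («Since the mapping `ψ` also preserves the level structures, it follows also from
(6.2) that `h ∈ Γ(N)`» — the injectivity step of Theorem 18; and conversely elements of `Γ(N)` identify
the quadruples `𝒜_Z ≅ 𝒜_{Z′}`). [cite: GoreskyTai2003RealModuli, §6.1 Def. 16 (d.), §6.2 (6.2), §7.4 proof of Theorem 18] -/
theorem forall_mapMatrix_proj_single_eq_proj_single_iff_mem {Z' : Matrix (Fin g) (Fin g) ℂ}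
    (hZ' : Z' ∈ siegelUpperHalfSpace g) (M : symplecticLatticeGroup (1 : Fin g → ℕ)) {N : ℕ} (hN : 0 < N) :
    (∀ k, mapMatrix (siegelPeriodEquiv hδ hZ) (siegelPeriodEquiv hδ hZ')
          (((M : GL (Fin g ⊕ Fin g) ℤ) : Matrix (Fin g ⊕ Fin g) (Fin g ⊕ Fin g) ℤ))
          (proj (siegelPeriodEquiv hδ hZ) (Pi.single k ((N : ℝ)⁻¹))) =
        proj (siegelPeriodEquiv hδ hZ') (Pi.single k ((N : ℝ)⁻¹))) ↔
      gDHom (1 : Fin g → ℕ) hδ M ∈ (siegelPrincipalGamma g N).map (symplecticIntHom g) := by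
  have h1 : ∀ k, proj (siegelPeriodEquiv hδ hZ') (Pi.single k ((N : ℝ)⁻¹)) =
      mapMatrix (siegelPeriodEquiv hδ hZ) (siegelPeriodEquiv hδ hZ') (1 : Matrix (Fin g ⊕ Fin g) (Fin g ⊕ Fin g) ℤ)
        (proj (siegelPeriodEquiv hδ hZ) (Pi.single k ((N : ℝ)⁻¹))) := fun k ↦ by
    rw [mapMatrix_proj, Matrix.map_one _ Int.cast_zero Int.cast_one, Matrix.one_mulVec]
  simp only [h1]
  rw [forall_mapMatrix_proj_single_eq_iff_forall_dvd _ _ _ _ hN, gDHom_mem_map_siegelPrincipalGamma_iff_forall_dvd]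

end Level

end SiegelModuli

end Literature.AlgebraicGeometry.ModuliOfAbelianVarieties
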